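import Literature.NumberTheory.EllipticCurves.Kato2004.AdmissibleZetaClassPositionProofs
import Literature.NumberTheory.EllipticCurves.Kato2004.IwasawaH2DataOfInjectivityProofs
import HarnessLib

/-!
# The position clause (A6′) of `AdmissibleZetaClassBody` READ AT THE BOTTOM LAYER: `proj₀` of an admissible
# class is an EXPLICIT `ℤ_p`-multiple of `proj₀` of the Λ-adic lift of its Kato family, and the `p`-adic
# valuation of the multiplier is `v_p(Ω⁺_f/Ω_W) − v_p(q·R⁻_𝟙·∏_{ℓ∣A,ℓ≠p} P_ℓ(ℓ⁻¹))` — THEOREMS ONLY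
# (no definition, no named fact)

Topic `NumberTheory/EllipticCurves`, sub-directory `Kato2004` (namespace = path). Cell `bsd-cm`, seat
`bsd-cm-prr-ty1` g7 (literature-prover). Companion of `Kato2004/AdmissibleZetaClass.lean` (v2, (A6′)) and
`Kato2004/AdmissibleZetaClassPositionProofs.lean` (the content `L • z₀ = r • y`, `L, r ≠ 0`). HONEST FRAMING: BSD is
not advanced; nothing about Kato's Main Conjecture or Perrin-Riou's conjecture is asserted; no Literature fact is
minted; no `instance`, no notation. This file is step K1 of the KERNEL CUT of the PRINT stub
`stub_rankOneCountReadingKato : TorsionFree.RankOneCountReading IsKatoZetaDescentDatumOfContra Kato2004.PRRatio` of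
the Kato–Perrin-Riou skeletons on cruxes stmt-BirchSwinnertonDyer-19945 / -19223 (cell bsd-cm) and of cell
bsd-potss's held input 27322: it turns the `e`-bookkeeping of (A6′) into a kernel identity at the layer where the
Perrin-Riou ratio is read.

## What is proved

Write `Λ = ℤ_p⟦T⟧` (`IwasawaAlgebra p`), `I : IwasawaH1Data W p K γ` for rkm's pinned `𝐇¹_Γ(T_pW)` and
`proj₀ : I.H → H¹(ℚ, T_pW)` for its bottom projection (`I.proj 0`; values in `H¹(ℤ[1/p], T_pW)`).

* §1 (imported) `IwasawaH1Data.proj_zero_smul` of `Kato2004/IwasawaH2DataOfInjectivityProofs.lean` (cell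
  bsd-cn100): **`proj₀ (g • x) = g(0) • proj₀ x`** for every `g ∈ Λ` — `T` acts as `0` at the bottom layer
  (`proj_zero_X_smul`) and constants act through `ℤ_p` (`proj_C_smul`): «`A = H¹(ℤ[1/p], T)` is a `Λ`-module through
  `Λ → Λ/T = ℤ_p`» of Kato's (14.14.1). [Kato §14.14 (14.14.1), p. 243]
* §2 valuation plumbing: the constant coefficient of a unit of `Λ` is a unit of `ℤ_p` (valuation `0` in `ℚ_p`);
  `v_p(∏_{ℓ ∈ prime(A)∖{p}} ℓ²) = 0`; the constant coefficient of Kato's multiplier `M̃` is NON-ZERO with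
  `v_p(M̃(0)) = v_p((R⁻_𝟙/q⁻)·∏_{ℓ∣A,ℓ≠p} ℓ²P_ℓ(ℓ⁻¹))` (`constantCoeff_katoMultiplier_cast` of `AdmissibleZetaClass.lean`).
* §3 THE CORE `IwasawaH1Data.exists_proj_zero_smul_eq_of_position`: from a position
  `((p : Λ)^{(−e)⁺}·M̃) • z₀ = (u·(p : Λ)^{e⁺}) • y` (`u ∈ Λˣ`, `e = v_p(λ/(q·q⁻))`, the (A5′)/(A6′) data of the body)
  one gets `c₁, c₂ ∈ ℤ_p ∖ {0}` with **`c₁ • proj₀ z₀ = c₂ • proj₀ y`** in `H¹(ℚ, T_pW)` and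
  **`v_p(c₂) = v_p(c₁) + v_p( λ / (q · R⁻_𝟙 · ∏_{ℓ∣A,ℓ≠p} P_ℓ(ℓ⁻¹)) )`** (`ℚ_p`-valuations; `λ = Ω⁺_f/Ω_W`,
  `R⁻_𝟙 = ratCuspFactor f true c d₁ a A d′`, `P_ℓ(ℓ⁻¹) = eulerFactorAtOne W N ℓ`). Here `c₁ = p^{(−e)⁺}·M̃(0)`,
  `c₂ = u(0)·p^{e⁺}`, and the identity is the computation `e⁺ − (−e)⁺ = e = v_p λ − v_p q − v_p q⁻`,
  `v_p M̃(0) = v_p R⁻_𝟙 − v_p q⁻ + Σ_{ℓ} v_p P_ℓ(ℓ⁻¹)` (`v_p ℓ² = 0` for `ℓ ≠ p`).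
* §4 the packaged forms `AdmissibleZetaClassBody.exists_proj_zero_position` /
  `IsAdmissibleZetaClass.exists_proj_zero_position`: an admissible `z₀` HAS such a family `(f, q, (c, d₁, a, A, d′),
  (z, x), y, λ)` and such `c₁, c₂` (the finer witnesses (A1)–(A2), (A5′), `e`, `u` are discarded; a consumer needing
  them destructures the body and calls §3).

## Why (the reading this serves; nothing of it is asserted here)

In `TorsionFree.RankOneCountReading IsKatoZetaDescentDatumOfContra Kato2004.PRRatio` the Perrin-Riou ratio `ℒ` of
`PRRatioBody` is `t·λ/(q·R⁻_𝟙·∏_{ℓ∣pA} P_ℓ(ℓ⁻¹))/log_ω(P)²` with `t = log_ω(loc_p proj₀ y)` for the Λ-adic lift `y`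
of ITS value-pinned family, while the descent datum's class is an ADMISSIBLE `z₀` with its own family `y′`. By §3,
`log_ω(loc_p proj₀ z₀) = (c₂/c₁)·log_ω(loc_p proj₀ y′)` as soon as the Kummer logarithm is `ℤ_p`-homogeneous, with
`v_p(c₂/c₁) = v_p λ − v_p(q′·R′⁻_𝟙·∏_{ℓ∣A′,ℓ≠p} P_ℓ(ℓ⁻¹))`; Kato's independence of the zeta element from the
choices (§13.9, p. 230: two families' lifts are proportional by exactly these constants) then gives
`v_p(log_ω loc_p proj₀ z₀) = v_p ℒ + 2·v_p log_ω(P) + v_p P_p(p⁻¹)`, and `P_p(p⁻¹) = eulerFactorAtOne W N p = 1`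
at an ADDITIVE `p` (`a_p = 0`, `p ∣ N`) — the rows of the reading. So the closed triple
(`Kato2004.PRRatio` v1.1, `IsAdmissibleZetaClass` v2, `IsKatoZetaDescentDatumOfContra`) is normalised
CONSISTENTLY for the count reading on its rows; this file is the Lean side of that audit (the `e`-bookkeeping),
the two remaining inputs (homogeneity of `HasLocPKummerLog`; Kato §13.9 proportionality) being separate items.

References: K. Kato, Astérisque 295 (2004): Thm. 12.5 (1) (pp. 221–222), Ex. 13.3 (p. 225), §13.9 and Lemma
13.10 (1) (pp. 229–230), §14.14 (14.14.1) (p. 243) [Kato2004Asterisque]; D. Burns, M. Kurihara, T. Sano,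
arXiv:1910.07404, Thm. 1.4 (p. 4), Conj. 2.8 (p. 10) [BurnsKuriharaSano2019]; B. Perrin-Riou, Ann. Inst. Fourier
43 (1993) §3.3 [PerrinRiou1993AIF]; tree: `Kato2004/AdmissibleZetaClass.lean` (`katoMultiplier`,
`constantCoeff_katoMultiplier_cast`, `AdmissibleZetaClassBody`), `Kato2004/AdmissibleZetaClassPositionProofs.lean`
(`eulerFactorAtOne_ne_zero`, `katoMultiplier_ne_zero`), `Kato2004/IwasawaCohomologyLevelZero.lean`
(`IwasawaH1Data.proj_zero_X_smul`), `Kato2004/IwasawaH2DataOfInjectivityProofs.lean` (`IwasawaH1Data.proj_zero_smul`), `Kato2004/PerrinRiouRatio.lean` (`PRRatioBody`), Mathlib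
`NumberTheory/Padics/PadicNumbers.lean` (`Padic.valuation_*`).
-/

noncomputable section

open scoped BigOperators NumberField TensorProduct Classical
open Field IsDedekindDomain NumberField CongruenceSubgroup ValuativeRel
open Literature.NumberTheory.GaloisRepresentations
open Literature.NumberTheory.GaloisRepresentations.PeriodRingData
open Literature.NumberTheory.GaloisRepresentations.IsNonarchimedeanLocalField
open Literature.NumberTheory.PAdicHodge
open Literature.NumberTheory.EllipticCurves Literature.NumberTheory.EllipticCurves.ModularForms
open Literature.NumberTheory.AdelicBaseChange Literature.NumberTheory.Automorphic

namespace Literature.NumberTheory.EllipticCurves.Kato2004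

open EulerSystemValues Rat.HeightOneSpectrum

/-! ## §1 `proj₀` is `Λ → ℤ_p`-semilinear

`IwasawaH1Data.proj_zero_smul : I.proj 0 (g • x) = PowerSeries.constantCoeff g • I.proj 0 x` is the tree theorem of
`Kato2004/IwasawaH2DataOfInjectivityProofs.lean` (cell bsd-cn100; imported, not re-declared). -/

/-! ## §2 Valuation plumbing: units of `Λ`, the prime-to-`p` factor `∏ ℓ²`, the augmentation of `M̃` -/

section Valuation

variable (p : ℕ) [Fact p.Prime]

/-- A unit of `ℤ_p` has `ℚ_p`-valuation `0`. [folklore] -/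
private theorem Padic.valuation_eq_zero_of_isUnit {u : ℤ_[p]} (hu : IsUnit u) : ((u : ℤ_[p]) : ℚ_[p]).valuation = 0 := by
  have hu0 : (u : ℚ_[p]) ≠ 0 := PadicInt.coe_ne_zero.mpr hu.ne_zero
  have h1 : ‖(u : ℚ_[p])‖ = 1 := by
    rw [← PadicInt.norm_def]
    exact PadicInt.isUnit_iff.mp hu
  rw [Padic.norm_eq_zpow_neg_valuation hu0] at h1
  have hp : (1 : ℝ) < p := by exact_mod_cast (Fact.out : p.Prime).one_lt
  have := (zpow_right_injective₀ (zero_lt_one.trans hp) hp.ne') (h1.trans (zpow_zero _).symm)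
  simpa using this

/-- The constant coefficient of a unit of `Λ = ℤ_p⟦T⟧` is a unit of `ℤ_p`. [folklore] -/
private theorem isUnit_constantCoeff_units (u : (IwasawaAlgebra p)ˣ) :
    IsUnit (PowerSeries.constantCoeff (u : IwasawaAlgebra p)) :=
  u.isUnit.map PowerSeries.constantCoeff

/-- `v_p(∏_{ℓ ∈ prime(A) ∖ {p}} ℓ²) = 0`: the primes of `A` other than `p` are `p`-adic units. [folklore] -/
private theorem padicValRat_prod_sq_primeFactors_erase (A : ℕ) :
    padicValRat p (∏ ℓ ∈ A.primeFactors.erase p, ((ℓ : ℚ) ^ 2)) = 0 := by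
  have hcast : (∏ ℓ ∈ A.primeFactors.erase p, ((ℓ : ℚ) ^ 2)) =
      ((∏ ℓ ∈ A.primeFactors.erase p, ℓ ^ 2 : ℕ) : ℚ) := by push_cast; rfl
  rw [hcast, padicValRat.of_nat, Nat.cast_eq_zero]
  refine padicValNat.eq_zero_of_not_dvd fun hdvd => ?_
  obtain ⟨ℓ, hℓ, hpl⟩ := (Prime.dvd_finsetProd_iff (Fact.out : p.Prime).prime _).mp hdvd
  have hℓp : ℓ.Prime := Nat.prime_of_mem_primeFactors (Finset.mem_of_mem_erase hℓ)
  have hne : ℓ ≠ p := Finset.ne_of_mem_erase hℓ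
  have h1 : p ∣ ℓ := (Fact.out : p.Prime).dvd_of_dvd_pow hpl
  exact hne (((Nat.prime_dvd_prime_iff_eq (Fact.out : p.Prime) hℓp).mp h1).symm)

omit [Fact p.Prime] in
/-- The prime-to-`p` integer `∏_{ℓ ∈ prime(A) ∖ {p}} ℓ²` is non-zero. [folklore] -/
private theorem prod_sq_primeFactors_erase_ne_zero (A : ℕ) :
    (∏ ℓ ∈ A.primeFactors.erase p, ((ℓ : ℚ) ^ 2)) ≠ 0 :=
  Finset.prod_ne_zero_iff.mpr fun _ hℓ =>
    pow_ne_zero _ (Nat.cast_ne_zero.mpr (Nat.prime_of_mem_primeFactors (Finset.mem_of_mem_erase hℓ)).ne_zero)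

/-- **The augmentation `M̃(0)` of Kato's Λ-adic multiplier is NON-ZERO** under the data (A3)/(A5′) of the body
(`R⁻_𝟙 ≠ 0`, `q⁻ ≠ 0`, the integer coordinates of the four cusp symbols), for ANY Galois elements: it is the
rational `(R⁻_𝟙/q⁻)·∏_{ℓ∣A,ℓ≠p} ℓ²P_ℓ(ℓ⁻¹)` (`constantCoeff_katoMultiplier_cast`) and `P_ℓ(ℓ⁻¹) ≠ 0`
(`eulerFactorAtOne_ne_zero`). [cite: Kato2004Asterisque, Lemma 13.10 (1) (p. 230), Ex. 13.3 (p. 225)] -/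
theorem constantCoeff_katoMultiplier_ne_zero (W : WeierstrassCurve ℚ) [W.IsElliptic] {N : ℕ} [NeZero N]
    {f : CuspForm (Gamma0 N) 2} (hf : IsNewformOf W f) (K : ZpExtension ℚ p) (c d a : ℤ) (A : ℕ) (d' : ℤ)
    {qm : ℚ} (hqm : qm ≠ 0) {n₁ n₂ n₃ n₄ : ℤ}
    (h₁ : ratMinusSymbol f ((a : ℚ) / A) = n₁ * qm) (h₂ : ratMinusSymbol f ((a * c : ℚ) / A) = n₂ * qm)
    (h₃ : ratMinusSymbol f ((a * d' : ℚ) / A) = n₃ * qm) (h₄ : ratMinusSymbol f ((a * c * d' : ℚ) / A) = n₄ * qm)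
    (hR : ratCuspFactor f true c d a A d' ≠ 0)
    (σc σd : absoluteGaloisGroup ℚ) (σℓ : ℕ → absoluteGaloisGroup ℚ) :
    PowerSeries.constantCoeff (katoMultiplier p c d n₁ n₂ n₃ n₄
        ((IwasawaCharacter.Psi p ℤ_[p] K σc : (PowerSeries ℤ_[p])ˣ) : IwasawaAlgebra p)
        ((IwasawaCharacter.Psi p ℤ_[p] K σd : (PowerSeries ℤ_[p])ˣ) : IwasawaAlgebra p)
        (A.primeFactors.erase p) (fun ℓ => W.LFunction ℓ) (fun ℓ => if ℓ ∣ N then 0 else 1)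
        (fun ℓ => ((IwasawaCharacter.Psi p ℤ_[p] K (σℓ ℓ) : (PowerSeries ℤ_[p])ˣ) : IwasawaAlgebra p))) ≠ 0 := by
  intro h0
  have hc := constantCoeff_katoMultiplier_cast p W f K c d a A d' hqm h₁ h₂ h₃ h₄ σc σd σℓ
  rw [h0, PadicInt.coe_zero] at hc
  have hrat : ratCuspFactor f true c d a A d' / qm *
      ∏ ℓ ∈ A.primeFactors.erase p, ((ℓ : ℚ) ^ 2 * eulerFactorAtOne W N ℓ) ≠ 0 := by
    refine mul_ne_zero (div_ne_zero hR hqm) (Finset.prod_ne_zero_iff.mpr fun ℓ hℓ => ?_)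
    have hℓp : ℓ.Prime := Nat.prime_of_mem_primeFactors (Finset.mem_of_mem_erase hℓ)
    exact mul_ne_zero (pow_ne_zero _ (Nat.cast_ne_zero.mpr hℓp.ne_zero)) (eulerFactorAtOne_ne_zero W hf hℓp)
  exact hrat (by exact_mod_cast hc.symm)

/-- **`v_p(M̃(0)) = v_p( (R⁻_𝟙/q⁻)·∏_{ℓ∣A,ℓ≠p} ℓ²P_ℓ(ℓ⁻¹) )`** (the augmentation of the multiplier read in `ℚ_p`).
[cite: Kato2004Asterisque, Lemma 13.10 (1) (p. 230), Ex. 13.3 (p. 225)] -/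
theorem valuation_constantCoeff_katoMultiplier (W : WeierstrassCurve ℚ) {N : ℕ} (f : CuspForm (Gamma0 N) 2)
    (K : ZpExtension ℚ p) (c d a : ℤ) (A : ℕ) (d' : ℤ) {qm : ℚ} (hqm : qm ≠ 0) {n₁ n₂ n₃ n₄ : ℤ}
    (h₁ : ratMinusSymbol f ((a : ℚ) / A) = n₁ * qm) (h₂ : ratMinusSymbol f ((a * c : ℚ) / A) = n₂ * qm)
    (h₃ : ratMinusSymbol f ((a * d' : ℚ) / A) = n₃ * qm) (h₄ : ratMinusSymbol f ((a * c * d' : ℚ) / A) = n₄ * qm)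
    (σc σd : absoluteGaloisGroup ℚ) (σℓ : ℕ → absoluteGaloisGroup ℚ) :
    ((PowerSeries.constantCoeff (katoMultiplier p c d n₁ n₂ n₃ n₄
        ((IwasawaCharacter.Psi p ℤ_[p] K σc : (PowerSeries ℤ_[p])ˣ) : IwasawaAlgebra p)
        ((IwasawaCharacter.Psi p ℤ_[p] K σd : (PowerSeries ℤ_[p])ˣ) : IwasawaAlgebra p)
        (A.primeFactors.erase p) (fun ℓ => W.LFunction ℓ) (fun ℓ => if ℓ ∣ N then 0 else 1)
        (fun ℓ => ((IwasawaCharacter.Psi p ℤ_[p] K (σℓ ℓ) : (PowerSeries ℤ_[p])ˣ) : IwasawaAlgebra p))) : ℤ_[p]) :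
        ℚ_[p]).valuation =
      padicValRat p (ratCuspFactor f true c d a A d' / qm *
          ∏ ℓ ∈ A.primeFactors.erase p, ((ℓ : ℚ) ^ 2 * eulerFactorAtOne W N ℓ)) := by
  rw [constantCoeff_katoMultiplier_cast p W f K c d a A d' hqm h₁ h₂ h₃ h₄ σc σd σℓ, Padic.valuation_ratCast]

end Valuation

/-! ## §3 The core: the position clause at the bottom layer, with the valuation of the multiplier -/

section Core

variable {W : WeierstrassCurve ℚ} [W.IsElliptic] {p : ℕ} [Fact p.Prime]
  [ContinuousSMul ℤ_[p] (W.tateModule p)] {K : ZpExtension ℚ p} {γ : absoluteGaloisGroup ℚ}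
  (I : IwasawaH1Data W p K γ)

/-- The rational identity behind the `e`-bookkeeping:
`(R/q⁻·∏_ℓ ℓ²P_ℓ)·(λ/(q·R·∏_ℓ P_ℓ)) = (λ/(q·q⁻))·∏_ℓ ℓ²`. [folklore] -/
private theorem augmentation_mul_perRatio_eq {E : Finset ℕ} {P : ℕ → ℚ} (hP : ∀ ℓ ∈ E, P ℓ ≠ 0)
    {R qm q perRatio : ℚ} (hR : R ≠ 0) (hqm : qm ≠ 0) (hq : q ≠ 0) :
    (R / qm * ∏ ℓ ∈ E, ((ℓ : ℚ) ^ 2 * P ℓ)) * (perRatio / (q * R * ∏ ℓ ∈ E, P ℓ)) =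
      perRatio / (q * qm) * ∏ ℓ ∈ E, ((ℓ : ℚ) ^ 2) := by
  have hprod : (∏ ℓ ∈ E, P ℓ) ≠ 0 := Finset.prod_ne_zero_iff.mpr hP
  rw [Finset.prod_mul_distrib]
  field_simp

/-- **THE CORE (position clause (A6′) at the bottom layer).** Let `f` be the newform of `W` (level `N`),
`(c, d₁, a, A, d′)` Kato parameters with `R⁻_𝟙 = ratCuspFactor f true c d₁ a A d′ ≠ 0`, `q ≠ 0` the constant of the
value law, `q⁻ ≠ 0` and `n₁ … n₄` the integer coordinates of the four cusp symbols in `ℤ·q⁻`, `λ ≠ 0` the period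
ratio, `e = v_p(λ/(q·q⁻))`, `σ_c, σ_{d₁}, σ_ℓ` any Galois elements, `u ∈ Λˣ`, and suppose the POSITION
`((p : Λ)^{(−e)⁺}·M̃) • z₀ = (u·(p : Λ)^{e⁺}) • y` in `I.H = 𝐇¹_Γ(T_pW)` (`M̃ = katoMultiplier …` through
`Ψ = IwasawaCharacter.Psi p ℤ_p K`). Then for `c₁ := p^{(−e)⁺}·M̃(0)` and `c₂ := u(0)·p^{e⁺}` (both `≠ 0` in `ℤ_p`):
**`c₁ • proj₀ z₀ = c₂ • proj₀ y`** in `H¹(ℚ, T_pW)` and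
**`v_p(c₂) = v_p(c₁) + v_p( λ / (q · R⁻_𝟙 · ∏_{ℓ ∣ A, ℓ ≠ p} P_ℓ(ℓ⁻¹)) )`**. Kernel: §1, §2 and
`e⁺ − (−e)⁺ = e`. [cite: Kato2004Asterisque, Thm. 12.5 (1) (pp. 221–222), Lemma 13.10 (1) (p. 230), §14.14 (14.14.1) (p. 243)] -/
theorem IwasawaH1Data.exists_proj_zero_smul_eq_of_position {N : ℕ} [NeZero N] {f : CuspForm (Gamma0 N) 2}
    (hf : IsNewformOf W f) (c d₁ a : ℤ) (A : ℕ) (d' : ℤ) {q qm perRatio : ℚ} (hq : q ≠ 0) (hqm : qm ≠ 0)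
    (hper : perRatio ≠ 0) {n₁ n₂ n₃ n₄ : ℤ}
    (h₁ : ratMinusSymbol f ((a : ℚ) / A) = n₁ * qm) (h₂ : ratMinusSymbol f ((a * c : ℚ) / A) = n₂ * qm)
    (h₃ : ratMinusSymbol f ((a * d' : ℚ) / A) = n₃ * qm) (h₄ : ratMinusSymbol f ((a * c * d' : ℚ) / A) = n₄ * qm)
    (hR : ratCuspFactor f true c d₁ a A d' ≠ 0)
    (σc σd : absoluteGaloisGroup ℚ) (σℓ : ℕ → absoluteGaloisGroup ℚ) {e : ℤ}
    (he : padicValRat p (perRatio / (q * qm)) = e) (u : (IwasawaAlgebra p)ˣ) {z₀ y : I.H}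
    (hpos : ((p : IwasawaAlgebra p) ^ (-e).toNat *
        katoMultiplier p c d₁ n₁ n₂ n₃ n₄
          ((IwasawaCharacter.Psi p ℤ_[p] K σc : (PowerSeries ℤ_[p])ˣ) : IwasawaAlgebra p)
          ((IwasawaCharacter.Psi p ℤ_[p] K σd : (PowerSeries ℤ_[p])ˣ) : IwasawaAlgebra p)
          (A.primeFactors.erase p) (fun ℓ => W.LFunction ℓ) (fun ℓ => if ℓ ∣ N then 0 else 1)
          (fun ℓ => ((IwasawaCharacter.Psi p ℤ_[p] K (σℓ ℓ) : (PowerSeries ℤ_[p])ˣ) : IwasawaAlgebra p))) • z₀ =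
      ((u : IwasawaAlgebra p) * (p : IwasawaAlgebra p) ^ e.toNat) • y) :
    ∃ c₁ c₂ : ℤ_[p], c₁ ≠ 0 ∧ c₂ ≠ 0 ∧ c₁ • I.proj 0 z₀ = c₂ • I.proj 0 y ∧
      ((c₂ : ℤ_[p]) : ℚ_[p]).valuation = ((c₁ : ℤ_[p]) : ℚ_[p]).valuation +
        padicValRat p (perRatio /
          (q * ratCuspFactor f true c d₁ a A d' * ∏ ℓ ∈ A.primeFactors.erase p, eulerFactorAtOne W N ℓ)) := by
  -- the multiplier and its augmentation
  set M := katoMultiplier p c d₁ n₁ n₂ n₃ n₄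
      ((IwasawaCharacter.Psi p ℤ_[p] K σc : (PowerSeries ℤ_[p])ˣ) : IwasawaAlgebra p)
      ((IwasawaCharacter.Psi p ℤ_[p] K σd : (PowerSeries ℤ_[p])ˣ) : IwasawaAlgebra p)
      (A.primeFactors.erase p) (fun ℓ => W.LFunction ℓ) (fun ℓ => if ℓ ∣ N then 0 else 1)
      (fun ℓ => ((IwasawaCharacter.Psi p ℤ_[p] K (σℓ ℓ) : (PowerSeries ℤ_[p])ˣ) : IwasawaAlgebra p)) with hM
  have hM0 : PowerSeries.constantCoeff M ≠ 0 := by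
    rw [hM]
    exact constantCoeff_katoMultiplier_ne_zero p W hf K c d₁ a A d' hqm h₁ h₂ h₃ h₄ hR σc σd σℓ
  have hMval : ((PowerSeries.constantCoeff M : ℤ_[p]) : ℚ_[p]).valuation =
      padicValRat p (ratCuspFactor f true c d₁ a A d' / qm *
        ∏ ℓ ∈ A.primeFactors.erase p, ((ℓ : ℚ) ^ 2 * eulerFactorAtOne W N ℓ)) := by
    rw [hM]
    exact valuation_constantCoeff_katoMultiplier p W f K c d₁ a A d' hqm h₁ h₂ h₃ h₄ σc σd σℓ
  have hp0 : (p : ℤ_[p]) ≠ 0 := NeZero.ne _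
  have hpQ : (p : ℚ_[p]) ≠ 0 := NeZero.ne _
  have hu0 : IsUnit (PowerSeries.constantCoeff (u : IwasawaAlgebra p)) := isUnit_constantCoeff_units p u
  -- the position at the bottom layer
  have key : PowerSeries.constantCoeff ((p : IwasawaAlgebra p) ^ (-e).toNat * M) • I.proj 0 z₀ =
      PowerSeries.constantCoeff ((u : IwasawaAlgebra p) * (p : IwasawaAlgebra p) ^ e.toNat) • I.proj 0 y := by
    rw [← I.proj_zero_smul, ← I.proj_zero_smul, hpos]
  rw [map_mul, map_pow, map_natCast, map_mul, map_pow, map_natCast] at key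
  refine ⟨(p : ℤ_[p]) ^ (-e).toNat * PowerSeries.constantCoeff M,
    PowerSeries.constantCoeff (u : IwasawaAlgebra p) * (p : ℤ_[p]) ^ e.toNat,
    mul_ne_zero (pow_ne_zero _ hp0) hM0, mul_ne_zero hu0.ne_zero (pow_ne_zero _ hp0), key, ?_⟩
  -- the valuation bookkeeping
  have hE : ∀ ℓ ∈ A.primeFactors.erase p, eulerFactorAtOne W N ℓ ≠ 0 := fun ℓ hℓ =>
    eulerFactorAtOne_ne_zero W hf (Nat.prime_of_mem_primeFactors (Finset.mem_of_mem_erase hℓ))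
  have hX : ratCuspFactor f true c d₁ a A d' / qm *
      ∏ ℓ ∈ A.primeFactors.erase p, ((ℓ : ℚ) ^ 2 * eulerFactorAtOne W N ℓ) ≠ 0 := by
    refine mul_ne_zero (div_ne_zero hR hqm) (Finset.prod_ne_zero_iff.mpr fun ℓ hℓ => ?_)
    exact mul_ne_zero (pow_ne_zero _ (Nat.cast_ne_zero.mpr
      (Nat.prime_of_mem_primeFactors (Finset.mem_of_mem_erase hℓ)).ne_zero)) (hE ℓ hℓ)
  have hY : perRatio /
      (q * ratCuspFactor f true c d₁ a A d' * ∏ ℓ ∈ A.primeFactors.erase p, eulerFactorAtOne W N ℓ) ≠ 0 :=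
    div_ne_zero hper (mul_ne_zero (mul_ne_zero hq hR) (Finset.prod_ne_zero_iff.mpr hE))
  have hXY : padicValRat p (ratCuspFactor f true c d₁ a A d' / qm *
        ∏ ℓ ∈ A.primeFactors.erase p, ((ℓ : ℚ) ^ 2 * eulerFactorAtOne W N ℓ)) +
      padicValRat p (perRatio /
        (q * ratCuspFactor f true c d₁ a A d' * ∏ ℓ ∈ A.primeFactors.erase p, eulerFactorAtOne W N ℓ)) = e := by
    rw [← padicValRat.mul hX hY, augmentation_mul_perRatio_eq hE hR hqm hq,
      padicValRat.mul (div_ne_zero hper (mul_ne_zero hq hqm)) (prod_sq_primeFactors_erase_ne_zero p A),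
      he, padicValRat_prod_sq_primeFactors_erase, add_zero]
  have hv₂ : (((PowerSeries.constantCoeff (u : IwasawaAlgebra p) * (p : ℤ_[p]) ^ e.toNat : ℤ_[p])) : ℚ_[p]).valuation =
      (e.toNat : ℤ) := by
    push_cast
    rw [Padic.valuation_mul (PadicInt.coe_ne_zero.mpr hu0.ne_zero) (pow_ne_zero _ hpQ),
      Padic.valuation_eq_zero_of_isUnit p hu0, Padic.valuation_pow, Padic.valuation_p, zero_add, mul_one]
  have hv₁ : ((((p : ℤ_[p]) ^ (-e).toNat * PowerSeries.constantCoeff M : ℤ_[p])) : ℚ_[p]).valuation =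
      ((-e).toNat : ℤ) + padicValRat p (ratCuspFactor f true c d₁ a A d' / qm *
        ∏ ℓ ∈ A.primeFactors.erase p, ((ℓ : ℚ) ^ 2 * eulerFactorAtOne W N ℓ)) := by
    rw [← hMval]
    push_cast
    rw [Padic.valuation_mul (pow_ne_zero _ hpQ) (PadicInt.coe_ne_zero.mpr hM0), Padic.valuation_pow,
      Padic.valuation_p, mul_one]
  rw [hv₂, hv₁, add_assoc, hXY]
  have := Int.toNat_sub_toNat_neg e
  omega

end Core

/-! ## §4 Packaged: an admissible class has a bottom-layer position with the printed valuation -/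

section Packaged

variable {W : WeierstrassCurve ℚ} [W.IsElliptic] [W.IsGloballyMinimal] {p : ℕ} [Fact p.Prime]
  [ContinuousSMul ℤ_[p] (W.tateModule p)] [Module.Free ℤ_[p] (W.tateModule p)]
  [Module.Finite ℤ_[p] (W.tateModule p)] {K : ZpExtension ℚ p} {hK : K.IsCyclotomic}
  {γ : absoluteGaloisGroup ℚ} {I : IwasawaH1Data W p K γ} {z₀ : I.H}

/-- **Bottom-layer position of an admissible class (body form).** If `z₀ ∈ I.H = 𝐇¹_Γ(T_pW)` is admissible
(`AdmissibleZetaClassBody`), then there are: `p ≠ 2`, the newform `f` of `W` (level `N`), embeddings `ι`, a constant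
`q ≠ 0` and a value datum `Λ`, Kato parameters `(c, d₁, a, A, d′)` with the printed guards and `R⁻_𝟙 ≠ 0`, THE family
`(z, x)` (`ZetaBody W p f ι q Λ c d₁ a A z x`), its Λ-adic lift `y ∈ I.H` (`I.proj n y = Cor(z_{n+1,∅})` for all `n`),
the period ratio `λ ≠ 0` (`plusPeriod f = λ·Ω_W`), and `c₁, c₂ ∈ ℤ_p ∖ {0}` with
**`c₁ • proj₀ z₀ = c₂ • proj₀ y`** and **`v_p(c₂) = v_p(c₁) + v_p(λ/(q·R⁻_𝟙·∏_{ℓ∣A,ℓ≠p} P_ℓ(ℓ⁻¹)))`**. The finer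
witnesses ((A1)–(A2), (A5′), `e`, `u`) are discarded (§3 serves a consumer who keeps them). Kernel.
[cite: Kato2004Asterisque, Thm. 12.5 (1) (pp. 221–222), Lemma 13.10 (1) (p. 230), §14.14 (14.14.1) (p. 243)] -/
theorem AdmissibleZetaClassBody.exists_proj_zero_position (h : AdmissibleZetaClassBody W p K hK I z₀) :
    ∃ (hp : p ≠ 2) (N : ℕ) (_ : NeZero N) (f : CuspForm (Gamma0 N) 2) (_ : IsNewformOf W f)
      (ι : (n : ℕ) → (CyclotomicField n ℚ →+* ℂ)) (q : ℚ)
      (Λ : ∀ (k : ℕ) (r : Finset (HeightOneSpectrum (𝓞 ℚ))),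
        H1 (tateRep W p) (cycSubgroup p k r) →ₗ[ℤ_[p]] ℚ_[p] ⊗[ℚ] CyclotomicField (cycLevel p k r) ℚ)
      (c d₁ a : ℤ) (A : ℕ) (d' : ℤ)
      (z : ∀ (k : ℕ) (r : (cyclotomicLevelsRat p (badPlaces c d₁ A N)).Ideals),
        H1 (tateRep W p) ((cyclotomicLevelsRat p (badPlaces c d₁ A N)).level k r.1))
      (x : ∀ (k : ℕ) (r : (cyclotomicLevelsRat p (badPlaces c d₁ A N)).Ideals),
        CyclotomicField (cycLevel p k r.1) ℚ)
      (y : I.H) (perRatio : ℚ) (c₁ c₂ : ℤ_[p]),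
      q ≠ 0 ∧ ZetaBody W p f ι ((q : ℚ) : ℝ) Λ c d₁ a A z x ∧
      (∀ n : ℕ, I.proj n y =
        levelToLayer W p hK hp (badPlaces c d₁ A N) n
          (z (n + 1) (cyclotomicLevelsRat p (badPlaces c d₁ A N)).idealOne)) ∧
      0 < A ∧ Int.gcd c (6 * p * A) = 1 ∧ Int.gcd d₁ (6 * p * N) = 1 ∧ (d₁ : ℤ) * d' ≡ 1 [ZMOD (A : ℤ)] ∧
      ratCuspFactor f true c d₁ a A d' ≠ 0 ∧ perRatio ≠ 0 ∧
      plusPeriod f = ((perRatio : ℚ) : ℝ) * W.realPeriodRat ∧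
      c₁ ≠ 0 ∧ c₂ ≠ 0 ∧ c₁ • I.proj 0 z₀ = c₂ • I.proj 0 y ∧
      ((c₂ : ℤ_[p]) : ℚ_[p]).valuation = ((c₁ : ℤ_[p]) : ℚ_[p]).valuation +
        padicValRat p (perRatio /
          (q * ratCuspFactor f true c d₁ a A d' * ∏ ℓ ∈ A.primeFactors.erase p, eulerFactorAtOne W N ℓ)) := by
  obtain ⟨hp, N, hN, f, hf, ι, q, Λ, hq, -, c, d₁, a, A, d', hA, hc, hd, hdd', hR, z, x, hzeta, y, hy,
    qm, perRatio, e, u, n₁, n₂, n₃, n₄, σc, σd, σℓ, hqm, -, h₁, h₂, h₃, h₄, -, -, -, hper0, hper, he,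
    hpos⟩ := h
  obtain ⟨c₁, c₂, hc₁, hc₂, hkey, hval⟩ :=
    I.exists_proj_zero_smul_eq_of_position hf c d₁ a A d' hq hqm.ne' hper0 h₁ h₂ h₃ h₄ hR σc σd σℓ he u hpos
  exact ⟨hp, N, hN, f, hf, ι, q, Λ, c, d₁, a, A, d', z, x, y, perRatio, c₁, c₂, hq, hzeta, hy, hA, hc, hd, hdd',
    hR, hper0, hper, hc₁, hc₂, hkey, hval⟩

omit [Module.Free ℤ_[p] (W.tateModule p)] [Module.Finite ℤ_[p] (W.tateModule p)] in
/-- **Bottom-layer position of an admissible class (closed form, any instances of the two `Prop`-valued structure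
facts, as in `isAdmissibleZetaClass_iff`).** [cite: Kato2004Asterisque, Thm. 12.5 (1) (pp. 221–222), Lemma 13.10 (1) (p. 230), §14.14 (14.14.1) (p. 243)] -/
theorem IsAdmissibleZetaClass.exists_proj_zero_position [Module.Free ℤ_[p] (W.tateModule p)]
    [Module.Finite ℤ_[p] (W.tateModule p)] (h : IsAdmissibleZetaClass W p K hK I z₀) :
    ∃ (hp : p ≠ 2) (N : ℕ) (_ : NeZero N) (f : CuspForm (Gamma0 N) 2) (_ : IsNewformOf W f)
      (ι : (n : ℕ) → (CyclotomicField n ℚ →+* ℂ)) (q : ℚ)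
      (Λ : ∀ (k : ℕ) (r : Finset (HeightOneSpectrum (𝓞 ℚ))),
        H1 (tateRep W p) (cycSubgroup p k r) →ₗ[ℤ_[p]] ℚ_[p] ⊗[ℚ] CyclotomicField (cycLevel p k r) ℚ)
      (c d₁ a : ℤ) (A : ℕ) (d' : ℤ)
      (z : ∀ (k : ℕ) (r : (cyclotomicLevelsRat p (badPlaces c d₁ A N)).Ideals),
        H1 (tateRep W p) ((cyclotomicLevelsRat p (badPlaces c d₁ A N)).level k r.1))
      (x : ∀ (k : ℕ) (r : (cyclotomicLevelsRat p (badPlaces c d₁ A N)).Ideals),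
        CyclotomicField (cycLevel p k r.1) ℚ)
      (y : I.H) (perRatio : ℚ) (c₁ c₂ : ℤ_[p]),
      q ≠ 0 ∧ ZetaBody W p f ι ((q : ℚ) : ℝ) Λ c d₁ a A z x ∧
      (∀ n : ℕ, I.proj n y =
        levelToLayer W p hK hp (badPlaces c d₁ A N) n
          (z (n + 1) (cyclotomicLevelsRat p (badPlaces c d₁ A N)).idealOne)) ∧
      0 < A ∧ Int.gcd c (6 * p * A) = 1 ∧ Int.gcd d₁ (6 * p * N) = 1 ∧ (d₁ : ℤ) * d' ≡ 1 [ZMOD (A : ℤ)] ∧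
      ratCuspFactor f true c d₁ a A d' ≠ 0 ∧ perRatio ≠ 0 ∧
      plusPeriod f = ((perRatio : ℚ) : ℝ) * W.realPeriodRat ∧
      c₁ ≠ 0 ∧ c₂ ≠ 0 ∧ c₁ • I.proj 0 z₀ = c₂ • I.proj 0 y ∧
      ((c₂ : ℤ_[p]) : ℚ_[p]).valuation = ((c₁ : ℤ_[p]) : ℚ_[p]).valuation +
        padicValRat p (perRatio /
          (q * ratCuspFactor f true c d₁ a A d' * ∏ ℓ ∈ A.primeFactors.erase p, eulerFactorAtOne W N ℓ)) :=
  ((isAdmissibleZetaClass_iff W p K hK I z₀).mp h).exists_proj_zero_position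

end Packaged

end Literature.NumberTheory.EllipticCurves.Kato2004

end
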